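import Literature.NumberTheory.Automorphic.SymPowTensorIwahoriCoefficients
import Literature.NumberTheory.Automorphic.HidaIndependenceOfWeightOrdinary
import Literature.NumberTheory.Automorphic.OrdinaryPartOfFiniteModuleProd
import HarnessLib

/-!
# Independence of weight for `⨂_j Sym^{m_j}` on the Hida tower of `GL₂`, all places above `p` at once

Topic `NumberTheory/Automorphic`; namespace `Literature.NumberTheory.Automorphic`; theorems only.
The multi-factor (`⊗` over the embeddings) version of `HidaIndependenceOfWeightGL2` /
`HidaIndependenceOfWeightTower` / `HidaIndependenceOfWeightOrdinary`, assembled from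
`SymPowTensorIwahoriCoefficients` (the change-of-coefficients data for the tree's
`SymPowTensor S J m = ⨂_j Sym^{m_j}(S²)` and the operator `U_p^{(r)} = [U (∏_{w ∈ s} t_{w,1}^r) U]`),
`IwahoriUpCrossPlace` (`heckeEnd (∏_w t_w^r) = ∏_w U_{w,1}^r`) and `OrdinaryPartOfFiniteModuleProd`
(the ordinary part of a product of commuting operators on a finite module is the intersection):

* `lowCharJ_eq_of_mem_doubleCosetQuot`, `lowCharJ_upElement`, `TameLevel.lowCharJ_eq_one_of_mem_level`
  — the product character `∏_j χ_{m_j}` is `1` on `U(b,c)` (radius-`b` hypothesis on every `red_j`)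
  and along the double coset of `U_p^{(r)}`;
* `TameLevel.level_heckeCohomology_comp_upElement` — the comparison
  `H^i(U(b,c), S(∏χ)) ≅ H^i(X_{U(b,c)}, S)` is `U_p^{(r)}`-equivariant;
* `TameLevel.independenceOfWeight_bijOn_level_tensor` — **for finite cohomology groups the composite
  `H^i(U(b,c), ⨂_j Sym^{m_j}(S²)) →(∏λ₁)_*→ H^i(U(b,c), S(∏χ)) ≅ H^i(X_{U(b,c)}, S)` is a bijection from
  the `U_p^{(r)}`-ordinary part onto `⋂ₙ range (heckeEnd (∏_w t_w^r))ⁿ`**;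
* `TameLevel.independenceOfWeight_bijOn_level_ordinaryPart_tensor` — the same with target the
  intersection over `w ∈ s` of the `U_{w,1}`-ordinary parts `⋂ₙ range (heckeEnd t_{w,1})ⁿ` (for
  `ι` the global embedding, `1 ≤ r ≤ c`, `s` a set of places above `p`).

This is [KhareThorne2017, §6.4, Prop. 6.13] / [Hida1994AIF, §2, Prop. 2.1 and §3] for torsion
coefficients `S` (e.g. `𝒪/ϖ^r`) and the full weight `⊗_τ Sym^{k−2}`: independence of weight of the
ordinary part for `Res_{F/ℚ} GL₂`.

## References

* C. Khare, J. A. Thorne, *Potential automorphy and the Leopoldt conjecture*, Amer. J. Math. 139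
  (2017), §6.4, Prop. 6.13 (arXiv:1409.7007, held). [KhareThorne2017]
* H. Hida, *p-ordinary cohomology groups for SL(2) over number fields*, Duke / *p-adic ordinary
  Hecke algebras for GL(2)*, Ann. Inst. Fourier 44 (1994), §2 Prop. 2.1, §3 (held). [Hida1994AIF]
-/

noncomputable section

open CategoryTheory IsDedekindDomain NumberField

namespace Literature.NumberTheory.Automorphic

/-! ### `⋂ₙ range (T^r)ⁿ = ⋂ₙ range Tⁿ` -/

section Generic

variable {R : Type*} [Semiring R] {M : Type*} [AddCommMonoid M] [Module R M]

/-- **The `T^r`-ordinary part is the `T`-ordinary part** (`1 ≤ r`). [folklore] -/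
theorem iInf_range_pow_pow_eq (T : Module.End R M) {r : ℕ} (hr1 : 1 ≤ r) :
    (⨅ n : ℕ, LinearMap.range ((T ^ r) ^ n)) = ⨅ n : ℕ, LinearMap.range (T ^ n) := by
  refine le_antisymm (le_iInf fun n => (iInf_le _ n).trans ?_) (le_iInf fun n => (iInf_le _ (r * n)).trans ?_)
  · rw [← pow_mul]
    rintro _ ⟨y, rfl⟩
    refine ⟨(T ^ (r * n - n)) y, ?_⟩
    rw [← Module.End.mul_apply, ← pow_add, Nat.add_sub_cancel' (Nat.le_mul_of_pos_left n hr1)]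
  · rw [← pow_mul]

end Generic

namespace IntegralWeightGL2

open BigHeckeGLn LevelAction

variable {K : Type} [Field K] [NumberField K] {S : Type} [CommRing S] {J : Type} [Fintype J]
  {v : J → HeightOneSpectrum (𝓞 K)} (red : ∀ j : J, (v j).adicCompletionIntegers K →+* S) (m : J → ℕ)

/-! ### The product character on Hecke elements -/

/-- **`∏χ` is constant along a double coset `U α U` on which it is trivial on `U`.** [folklore] -/
theorem lowCharJ_eq_of_mem_doubleCosetQuot {U : Subgroup (FiniteAdelicGL 2 K)}
    (hU : U.toSubmonoid ≤ multiIwahoriMonoid K v red)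
    (hχ : ∀ (u : FiniteAdelicGL 2 K) (hu : u ∈ U), lowCharJ K v red m ⟨u, hU hu⟩ = 1)
    {α : FiniteAdelicGL 2 K} (hα : α ∈ multiIwahoriMonoid K v red) {y : FiniteAdelicGL 2 K}
    (hy : y ∈ multiIwahoriMonoid K v red)
    (hyd : (y : FiniteAdelicGL 2 K ⧸ U) ∈ ArithmeticQuotient.doubleCosetQuot U α) :
    lowCharJ K v red m ⟨y, hy⟩ = lowCharJ K v red m ⟨α, hα⟩ := by
  obtain ⟨u, hu, huy⟩ := exists_mk_eq_of_mem_doubleCosetQuot hyd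
  have hu' : (u * α)⁻¹ * y ∈ U := QuotientGroup.eq.1 huy
  have hy_eq : (⟨y, hy⟩ : multiIwahoriMonoid K v red) =
      ⟨u, hU hu⟩ * ⟨α, hα⟩ * ⟨(u * α)⁻¹ * y, hU hu'⟩ :=
    Subtype.ext (by simp [mul_assoc])
  rw [hy_eq, map_mul, map_mul, hχ u hu, hχ _ hu', one_mul, mul_one]

/-- `(∏χ)(g) = 1` as soon as every `red_j((g_{v j})₁₁)^{m_j} = 1`. [folklore] -/
theorem lowCharJ_eq_one_of_forall (g : multiIwahoriMonoid K v red)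
    (h : ∀ j, redMatrix K (v j) (red j) (inclAt K v red j g) 1 1 ^ (m j) = 1) : lowCharJ K v red m g = 1 := by
  refine LinearMap.ext fun c => ?_
  rw [lowCharJ_apply, lowCharFunJ_apply, Finset.prod_eq_one (fun j _ => h j), one_mul, Module.End.one_apply]

omit [Fintype J] in
/-- `χ_n(g) = 1` forces `red((g_w)₁₁)^n = 1`. [folklore] -/
theorem redMatrix_pow_eq_one_of_lowChar_eq_one {w : HeightOneSpectrum (𝓞 K)}
    {red' : w.adicCompletionIntegers K →+* S} {n : ℕ} {g : iwahoriMonoid K w red'}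
    (h : lowChar K w red' n g = 1) : redMatrix K w red' g 1 1 ^ n = 1 := by
  have h1 := LinearMap.congr_fun h (1 : S)
  rwa [lowChar_apply, mul_one, Module.End.one_apply] at h1

/-- **`(∏χ)(∏_{w ∈ s} t_w^r) = 1`** (`(t_w^r)_w = diag(ϖ^r, 1)`). [folklore] -/
theorem lowCharJ_upElement {s : Finset (HeightOneSpectrum (𝓞 K))} (hs : ∀ j, v j ∈ s) (r : ℕ) :
    lowCharJ K v red m ⟨TameLevel.upElement s r, upElement_mem_multiIwahoriMonoid K v red hs r⟩ = 1 := by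
  refine lowCharJ_eq_one_of_forall red m _ fun j => ?_
  have h := redMatrix_pow_eq_one_of_lowChar_eq_one (lowChar_heckeElement_pow (red j) (m j) r)
  have h2 : redMatrix K (v j) (red j) (inclAt K v red j
      ⟨TameLevel.upElement s r, upElement_mem_multiIwahoriMonoid K v red hs r⟩) 1 1 =
      redMatrix K (v j) (red j) ⟨heckeElement 2 K (v j) 1 ^ r, heckeElement_pow_mem_iwahoriMonoid K (v j) (red j) r⟩ 1 1 :=
    redMatrix_eq_of_localComponent_eq (localComponent_upElement_of_mem (hs j)) 1 1
  rw [h2]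
  exact h

/-! ### The ordinary parts are exchanged (level `U` in the multi-place Iwahori monoid) -/

section Ordinary

variable {Γ : Type} [Group Γ] (ι : Γ →* FiniteAdelicGL 2 K) {U : Subgroup (FiniteAdelicGL 2 K)}
  (hU : U.toSubmonoid ≤ multiIwahoriMonoid K v red) {s : Finset (HeightOneSpectrum (𝓞 K))}
  (hs : ∀ j, v j ∈ s) (r i : ℕ)

/-- `(∏λ₁)_*` maps the `U_p^{(r)}`-ordinary part of `H^i(U, ⨂_j Sym^{m_j}(S²))` into that of
`H^i(U, S(∏χ))`. [folklore] -/
theorem mapsTo_pushforwardCohomology_ordinaryPart_tensor :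
    Set.MapsTo (pushforwardCohomology ι (multiIwahoriMonoid K v red) (symPowCoeffJ K v red m)
        (lowCharJ K v red m) U (coeffX₁J S m) (coeffX₁J_comp_symPowCoeffJ m) i).hom
      (⨅ n : ℕ, LinearMap.range (heckeCohomology ι (multiIwahoriMonoid K v red) (symPowCoeffJ K v red m) U hU
        (upElement_mem_multiIwahoriMonoid K v red hs r) i ^ n) : Submodule S _)
      (⨅ n : ℕ, LinearMap.range (heckeCohomology ι (multiIwahoriMonoid K v red) (lowCharJ K v red m) U hU
        (upElement_mem_multiIwahoriMonoid K v red hs r) i ^ n) : Submodule S _) :=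
  mapsTo_iInf_range_pow_of_comp_eq
    (heckeCohomology_comp_pushforwardCohomology ι _ _ _ U _ _ hU _ i)

/-- `Θ` maps the `U_p^{(r)}`-ordinary part of `H^i(U, S(∏χ))` into that of
`H^i(U, ⨂_j Sym^{m_j}(S²))`. [folklore] -/
theorem mapsTo_raiseCohomology_ordinaryPart_tensor
    (hr : ∀ j, red j ⟨_, uniformizerAt_mem_adicCompletionIntegers K (v j)⟩ ^ r = 0) :
    Set.MapsTo (raiseCohomology ι (multiIwahoriMonoid K v red) (symPowCoeffJ K v red m)
        (lowCharJ K v red m) U (smulX₁powJ S m) (TameLevel.upElement s r) (coeffX₁J S m)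
        (coeffX₁J_comp_symPowCoeffJ m) (coeffX₁J_comp_smulX₁powJ S m) hU
        (upElement_mem_multiIwahoriMonoid K v red hs r)
        (heckeFactorsThroughJ m hU (upElement_mem_multiIwahoriMonoid K v red hs r)
          (redMatrix_upElement_col_zero hs r hr)) i).hom
      (⨅ n : ℕ, LinearMap.range (heckeCohomology ι (multiIwahoriMonoid K v red) (lowCharJ K v red m) U hU
        (upElement_mem_multiIwahoriMonoid K v red hs r) i ^ n) : Submodule S _)
      (⨅ n : ℕ, LinearMap.range (heckeCohomology ι (multiIwahoriMonoid K v red) (symPowCoeffJ K v red m) U hU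
        (upElement_mem_multiIwahoriMonoid K v red hs r) i ^ n) : Submodule S _) :=
  mapsTo_iInf_range_pow_of_comp_eq
    (raiseCohomology_comp_heckeCohomology ι _ _ _ U _ _ _ _ _ hU _ _ i)

/-- **Independence of weight for `⨂_j Sym^{m_j}` (finite coefficients, level `U`).**  For a level `U`
in the multi-place Iwahori monoid, `s ⊇ {v j}`, `red_j(ϖ_{v j})^r = 0` for all `j`, and finite
cohomology groups, `(∏λ₁)_*` restricts to a bijection of the `U_p^{(r)}`-ordinary parts.
[cite: KhareThorne2017, §6.4, Prop. 6.13] [cite: Hida1994AIF, §2, Prop. 2.1] -/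
theorem independenceOfWeight_bijOn_ordinaryPart_tensor
    (hr : ∀ j, red j ⟨_, uniformizerAt_mem_adicCompletionIntegers K (v j)⟩ ^ r = 0)
    [Finite (cohomology ι (multiIwahoriMonoid K v red) (symPowCoeffJ K v red m) U i)]
    [Finite (cohomology ι (multiIwahoriMonoid K v red) (lowCharJ K v red m) U i)] :
    Set.BijOn (pushforwardCohomology ι (multiIwahoriMonoid K v red) (symPowCoeffJ K v red m)
        (lowCharJ K v red m) U (coeffX₁J S m) (coeffX₁J_comp_symPowCoeffJ m) i).hom
      (⨅ n : ℕ, LinearMap.range (heckeCohomology ι (multiIwahoriMonoid K v red) (symPowCoeffJ K v red m) U hU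
        (upElement_mem_multiIwahoriMonoid K v red hs r) i ^ n) : Submodule S _)
      (⨅ n : ℕ, LinearMap.range (heckeCohomology ι (multiIwahoriMonoid K v red) (lowCharJ K v red m) U hU
        (upElement_mem_multiIwahoriMonoid K v red hs r) i ^ n) : Submodule S _) :=
  independenceOfWeight_bijOn_tensor m ι hU hs r hr i
    (mapsTo_pushforwardCohomology_ordinaryPart_tensor red m ι hU hs r i)
    (mapsTo_raiseCohomology_ordinaryPart_tensor red m ι hU hs r i hr)
    (injOn_iInf_range_pow _) (surjOn_iInf_range_pow _)

end Ordinary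

end IntegralWeightGL2

namespace BigHeckeGLn

open LevelAction IntegralWeightGL2

variable {K : Type} [Field K] [NumberField K] {p : ℕ} [Fact p.Prime] (𝒰 : TameLevel 2 K p)
  {S : Type} [CommRing S] {J : Type} [Fintype J] {v : J → HeightOneSpectrum (𝓞 K)}
  (hv : ∀ j, (p : 𝓞 K) ∈ (v j).asIdeal) (red : ∀ j : J, (v j).adicCompletionIntegers K →+* S)
  {b c : ℕ} (hbc : b ≤ c)
  (hred : ∀ j (x : (v j).adicCompletionIntegers K),
    Valued.v (x : (v j).adicCompletion K) ≤ (WithZero.exp (-(b : ℤ)) : WithZero (Multiplicative ℤ)) →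
      red j x = 0)

namespace TameLevel

include hv hbc hred in
omit [Fintype J] in
/-- `U(b,c)` lies in the multi-place Iwahori monoid (radius-`b` hypothesis at every factor, `b ≤ c`).
[folklore] -/
theorem level_le_multiIwahoriMonoid : (𝒰.level b c).toSubmonoid ≤ multiIwahoriMonoid K v red :=
  fun _ hu => mem_multiIwahoriMonoid_iff.2 fun j => 𝒰.level_le_iwahoriMonoid' (hv j) (red j) hbc (hred j) hu

/-- **`∏χ ≡ 1` on `U(b,c)`.** [cite: KhareThorne2017, §6.4] -/
theorem lowCharJ_eq_one_of_mem_level (m : J → ℕ) (u : FiniteAdelicGL 2 K) (hu : u ∈ 𝒰.level b c) :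
    lowCharJ K v red m ⟨u, 𝒰.level_le_multiIwahoriMonoid hv red hbc hred hu⟩ = 1 :=
  lowCharJ_eq_one_of_forall red m _ fun j =>
    redMatrix_pow_eq_one_of_lowChar_eq_one (𝒰.lowChar_eq_one_of_mem_level (hv j) (red j) hbc (hred j) (m j) u hu)

/-! ### Independence of weight on `H^i(X_{U(b,c)}, S)` for `U_p^{(r)}` -/

variable {Γ : Type} [Group Γ] (ι : Γ →* FiniteAdelicGL 2 K) (m : J → ℕ)
  {s : Finset (HeightOneSpectrum (𝓞 K))} (hs : ∀ j, v j ∈ s) (r i : ℕ)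

/-- **The comparison `H^i(U(b,c), S(∏χ)) ≅ H^i(X_{U(b,c)}, S)` is `U_p^{(r)}`-equivariant.**
[cite: KhareThorne2017, §6.4] -/
theorem level_heckeCohomology_comp_upElement :
    (cohomologyIso ι (multiIwahoriMonoid K v red) (lowCharJ K v red m) (𝒰.level b c)
        (𝒰.level_le_multiIwahoriMonoid hv red hbc hred) (𝒰.lowCharJ_eq_one_of_mem_level hv red hbc hred m) i).hom.hom ∘ₗ
      heckeCohomology ι (multiIwahoriMonoid K v red) (lowCharJ K v red m) (𝒰.level b c)
        (𝒰.level_le_multiIwahoriMonoid hv red hbc hred) (upElement_mem_multiIwahoriMonoid K v red hs r) i =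
      ArithmeticQuotient.heckeEnd S (𝒰.level b c) (TameLevel.upElement s r) S ι i ∘ₗ
        (cohomologyIso ι (multiIwahoriMonoid K v red) (lowCharJ K v red m) (𝒰.level b c)
          (𝒰.level_le_multiIwahoriMonoid hv red hbc hred) (𝒰.lowCharJ_eq_one_of_mem_level hv red hbc hred m) i).hom.hom :=
  heckeCohomology_comp_cohomologyIso_hom_of_eq_one ι _ _ (upElement_mem_multiIwahoriMonoid K v red hs r)
    (fun y hy hyd => by
      rw [lowCharJ_eq_of_mem_doubleCosetQuot red m _ (𝒰.lowCharJ_eq_one_of_mem_level hv red hbc hred m)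
        (upElement_mem_multiIwahoriMonoid K v red hs r) hy hyd, lowCharJ_upElement red m hs r]) i

/-- **Independence of weight on the Hida tower for `⨂_j Sym^{m_j}` (finite coefficients, all places
above `p` at once).**  For `b ≤ c`, reductions `red_j : 𝒪_{v j} → S` killing the closed balls of radius
`|ϖ|^b` with `red_j(ϖ_{v j})^r = 0`, `s ⊇ {v j}`, and finite cohomology groups, the composite
`H^i(U(b,c), ⨂_j Sym^{m_j}(S²)) →(∏λ₁)_*→ H^i(U(b,c), S(∏χ)) ≅ H^i(X_{U(b,c)}, S)` restricts to a bijection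
from the `U_p^{(r)}`-ordinary part onto `⋂ₙ range (heckeEnd (∏_{w ∈ s} t_w^r))ⁿ`.
[cite: KhareThorne2017, §6.4, Prop. 6.13] [cite: Hida1994AIF, §2, Prop. 2.1] -/
theorem independenceOfWeight_bijOn_level_tensor
    (hr : ∀ j, red j ⟨_, uniformizerAt_mem_adicCompletionIntegers K (v j)⟩ ^ r = 0)
    [Finite (cohomology ι (multiIwahoriMonoid K v red) (symPowCoeffJ K v red m) (𝒰.level b c) i)]
    [Finite (ArithmeticQuotient.cohomology S ι (𝒰.level b c) S i)] :
    Set.BijOn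
      ((cohomologyIso ι (multiIwahoriMonoid K v red) (lowCharJ K v red m) (𝒰.level b c)
          (𝒰.level_le_multiIwahoriMonoid hv red hbc hred) (𝒰.lowCharJ_eq_one_of_mem_level hv red hbc hred m) i).hom.hom ∘
        (pushforwardCohomology ι (multiIwahoriMonoid K v red) (symPowCoeffJ K v red m) (lowCharJ K v red m)
          (𝒰.level b c) (coeffX₁J S m) (coeffX₁J_comp_symPowCoeffJ m) i).hom)
      (⨅ n : ℕ, LinearMap.range (heckeCohomology ι (multiIwahoriMonoid K v red) (symPowCoeffJ K v red m)
        (𝒰.level b c) (𝒰.level_le_multiIwahoriMonoid hv red hbc hred)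
        (upElement_mem_multiIwahoriMonoid K v red hs r) i ^ n) : Submodule S _)
      (⨅ n : ℕ, LinearMap.range
        (ArithmeticQuotient.heckeEnd S (𝒰.level b c) (TameLevel.upElement s r) S ι i ^ n) : Submodule S _) := by
  have hU := 𝒰.level_le_multiIwahoriMonoid hv red hbc hred
  have hα := upElement_mem_multiIwahoriMonoid K v red hs r
  haveI : Finite (cohomology ι (multiIwahoriMonoid K v red) (lowCharJ K v red m) (𝒰.level b c) i) :=
    Finite.of_equiv _ (cohomologyIso ι (multiIwahoriMonoid K v red) (lowCharJ K v red m) (𝒰.level b c)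
      hU (𝒰.lowCharJ_eq_one_of_mem_level hv red hbc hred m) i).toLinearEquiv.symm.toEquiv
  have hiso := bijOn_iInf_range_pow_of_linearEquiv
    (cohomologyIso ι (multiIwahoriMonoid K v red) (lowCharJ K v red m) (𝒰.level b c)
      hU (𝒰.lowCharJ_eq_one_of_mem_level hv red hbc hred m) i).toLinearEquiv
    (U := heckeCohomology ι (multiIwahoriMonoid K v red) (lowCharJ K v red m) (𝒰.level b c) hU hα i)
    (U' := ArithmeticQuotient.heckeEnd S (𝒰.level b c) (TameLevel.upElement s r) S ι i)
    (𝒰.level_heckeCohomology_comp_upElement hv red hbc hred ι m hs r i)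
  exact hiso.comp (independenceOfWeight_bijOn_ordinaryPart_tensor red m ι hU hs r i hr)

/-- **Independence of weight onto the intersection of the `U_{w,1}`-ordinary parts.**  Same
hypotheses, `ι` the global embedding, `U` maximal above `p`, `1 ≤ r ≤ c` and `s` a set of places above
`p`: the target ordinary part `⋂ₙ range (heckeEnd (∏_{w ∈ s} t_w^r))ⁿ` is
`⨅_{w ∈ s} ⋂ₙ range (heckeEnd t_{w,1})ⁿ` (`heckeEnd (∏_w t_w^r) = ∏_w U_{w,1}^r`, the factors commute,
and the module is finite). [cite: KhareThorne2017, §6.4, Prop. 6.13] [cite: Hida1994AIF, §3] -/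
theorem independenceOfWeight_bijOn_level_ordinaryPart_tensor (h𝒰 : 𝒰.IsMaximalAbove) (hr1 : 1 ≤ r)
    (hrc : r ≤ c) (hsp : ∀ w ∈ s, (p : 𝓞 K) ∈ w.asIdeal)
    (hr : ∀ j, red j ⟨_, uniformizerAt_mem_adicCompletionIntegers K (v j)⟩ ^ r = 0)
    [Finite (cohomology (globalEmbedding 2 K) (multiIwahoriMonoid K v red) (symPowCoeffJ K v red m) (𝒰.level b c) i)]
    [Finite (ArithmeticQuotient.cohomology S (globalEmbedding 2 K) (𝒰.level b c) S i)] :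
    Set.BijOn
      ((cohomologyIso (globalEmbedding 2 K) (multiIwahoriMonoid K v red) (lowCharJ K v red m) (𝒰.level b c)
          (𝒰.level_le_multiIwahoriMonoid hv red hbc hred) (𝒰.lowCharJ_eq_one_of_mem_level hv red hbc hred m) i).hom.hom ∘
        (pushforwardCohomology (globalEmbedding 2 K) (multiIwahoriMonoid K v red) (symPowCoeffJ K v red m)
          (lowCharJ K v red m) (𝒰.level b c) (coeffX₁J S m) (coeffX₁J_comp_symPowCoeffJ m) i).hom)
      (⨅ n : ℕ, LinearMap.range (heckeCohomology (globalEmbedding 2 K) (multiIwahoriMonoid K v red)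
        (symPowCoeffJ K v red m) (𝒰.level b c) (𝒰.level_le_multiIwahoriMonoid hv red hbc hred)
        (upElement_mem_multiIwahoriMonoid K v red hs r) i ^ n) : Submodule S _)
      (⨅ w ∈ s, ⨅ n : ℕ, LinearMap.range
        (ArithmeticQuotient.heckeEnd S (𝒰.level b c) (heckeElement 2 K w 1) S (globalEmbedding 2 K) i ^ n) :
          Submodule S _) := by
  have h := 𝒰.independenceOfWeight_bijOn_level_tensor hv red hbc hred (globalEmbedding 2 K) m hs r i hr
  rw [𝒰.heckeEnd_level_upElement S S h𝒰 hrc i s hsp, iInf_range_pow_noncommProd_eq] at h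
  have hcongr : (⨅ w ∈ s, ⨅ n : ℕ, LinearMap.range
      ((ArithmeticQuotient.heckeEnd S (𝒰.level b c) (heckeElement 2 K w 1) S (globalEmbedding 2 K) i ^ r) ^ n)) =
      ⨅ w ∈ s, ⨅ n : ℕ, LinearMap.range
        (ArithmeticQuotient.heckeEnd S (𝒰.level b c) (heckeElement 2 K w 1) S (globalEmbedding 2 K) i ^ n) :=
    iInf_congr fun w => iInf_congr fun _ => iInf_range_pow_pow_eq _ hr1
  rwa [hcongr] at h

end TameLevel

end BigHeckeGLn

end Literature.NumberTheory.Automorphic
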